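/-
Copyright (c) 2026 the pub-hodgecm-mathlib formalisation cell (harness21).  Prover seat hodgecm-mathlib-K2E5-p16 (g4): Track B «K2-LIT»,
hLiu418 = stmt-HodgeConjecture-24832, ROAD Φ organ Φ6b-2 (self-offered on the K2 bus under LEAD F0P6-plan (g12) ∕ co-dealer K2E5-plan (g5)):
DEFS leaf — Shimura's `η(g, h; α, β)` on `Herm₂(ℂ)`, the vehicle of the analytic continuation of `ξ`; 2026-09-04.
-/
import Summits.HodgeConjecture.HodgeConjecture.Theorems.K2LiuHermTwoGammaDefs              -- ★ p857639: `hermTwo` + API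
import Mathlib.MeasureTheory.Function.SpecialFunctions.Basic
import HarnessLib

/-!
# Crux `HLiu418`, ROAD Φ, organ Φ6b-2 — DEFS leaf: Shimura's function `η(g, h; α, β)` on `Herm₂(ℂ)`

Cell `hodgecm-mathlib`, crux item hLiu418 = `stmt-HodgeConjecture-24832`, route of record `HCCMUnconditional`; squad K2, LEAD F0P6-plan (g12), co-dealer
K2E5-plan (g5) (PRICING-Q41∞-bis: «ξ on Herm₂: definition, convergence, Γ-normalisation, entire continuation for det β ≠ 0»), prover K2E5-p16 (g4).
DEFINITIONS WITH BODIES + `rfl`∕algebraic API (no instance, no notation, no named-fact hypothesis, no `sorry`); lane `--supports stmt-HodgeConjecture-24832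
--as helper` (count-neutral; definitions ⇒ review lane).

THE OBJECT [Shimura1982, §1 (1.26)–(1.29), §3, Case II, m = κ = 2].  For `g > 0`, `h ∈ Herm₂(ℂ)`, `(α, β) ∈ ℂ²`:
  `η(g, h; α, β) = ∫_{x ∈ Herm₂(ℂ), x + h > 0, x − h > 0} e^{−τ(g x)} det(x + h)^{α−2} det(x − h)^{β−2} dx`
(`dx` = Lebesgue measure of the chart `x = hermTwo c`; the powers are powers of POSITIVE REALS on the domain — no branch).  It is linked to `ξ` by
`ξ(g, h; α, β) = i^{2β−2α}·(const)·Γ₂(α)^{−1}Γ₂(β)^{−1}·η(2g, πh; α, β)` (two tube formulas ★ Φ6b-0 + Fourier inversion; sequel), converges for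
`re α, re β > 1`, and for `h > 0` for EVERY `α` (`x − h > 0 ⇒ x + h > 2h`, `det(x+h) ≥ det(2h) > 0`) — whence the continuation of `ξ` in `α`
(Shimura Thm 3.1); ★-to-be `K2LiuHermTwoEtaConvergence`.

CONTENTS.  `etaTwoSet h` (the domain `{x ± h > 0}` in the chart), `etaTwoIntegrand g h α β`, `etaTwo g h α β := ∫ c in etaTwoSet h, etaTwoIntegrand …`;
API: unfolding lemmas, `hermTwo_add` ∕ `hermTwo_sub` ∕ `hermTwo_smul` (linearity of the chart), `mem_etaTwoSet_iff`, `measurableSet_etaTwoSet`,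
`isOpen_etaTwoSet`, `etaTwoSet_eq_of_posSemidef` (for `h ≥ 0` the domain is `{x − h > 0}`), measurability of the integrand.
HONEST LABEL.  Count-neutral DEFS leaf; it pays nothing by itself: `HC_CM` is proved only modulo the 7 printed citations (2 remaining named inputs:
hLiu418 = `stmt-HodgeConjecture-24832`, h413 = `stmt-HodgeConjecture-24833`) until rung 0 closes.
-/

set_option autoImplicit false
-- the mandated namespace repeats the single-problem summit's segment (`HodgeConjecture.HodgeConjecture`)
set_option linter.dupNamespace false

noncomputable section

open Complex MeasureTheory Set
open scoped ComplexOrder ComplexConjugate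

namespace Summit.HodgeConjecture.HodgeConjecture.Cruxes.HLiu418.K2LiuHermTwoEtaDefs

open Summit.HodgeConjecture.HodgeConjecture.Cruxes.HLiu418.K2LiuHermTwoGammaDefs

/-! ## Linearity of the chart -/

/-- The chart is additive: `hermTwo (c + d) = hermTwo c + hermTwo d`. -/
theorem hermTwo_add (c d : ℝ × ℂ × ℝ) : hermTwo (c + d) = hermTwo c + hermTwo d := by
  ext i j
  fin_cases i <;> fin_cases j <;> simp [hermTwo]

/-- The chart respects subtraction: `hermTwo (c − d) = hermTwo c − hermTwo d`. -/
theorem hermTwo_sub (c d : ℝ × ℂ × ℝ) : hermTwo (c - d) = hermTwo c - hermTwo d := by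
  ext i j
  fin_cases i <;> fin_cases j <;> simp [hermTwo]

/-- The chart is real-homogeneous: `hermTwo (r • c) = r • hermTwo c`. -/
theorem hermTwo_smul (r : ℝ) (c : ℝ × ℂ × ℝ) : hermTwo (r • c) = (r : ℂ) • hermTwo c := by
  ext i j
  fin_cases i <;> fin_cases j <;> simp [hermTwo, Complex.real_smul]

/-- `hermTwo 0 = 0`. -/
@[simp] theorem hermTwo_zero : hermTwo (0 : ℝ × ℂ × ℝ) = 0 := by
  ext i j
  fin_cases i <;> fin_cases j <;> simp [hermTwo]

/-! ## The domain, the integrand, the function -/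

/-- The domain of `η(g, h; ·)` in the chart: `{x = hermTwo c | x + h > 0 and x − h > 0}`. -/
def etaTwoSet (h : Matrix (Fin 2) (Fin 2) ℂ) : Set (ℝ × ℂ × ℝ) :=
  {c | (hermTwo c + h).PosDef ∧ (hermTwo c - h).PosDef}

/-- THE INTEGRAND OF SHIMURA'S `η` on `Herm₂(ℂ)` in the chart: `e^{−τ(g x)} det(x + h)^{α−2} det(x − h)^{β−2}` (principal powers; on
`etaTwoSet h` both determinants are positive reals). -/
def etaTwoIntegrand (g h : Matrix (Fin 2) (Fin 2) ℂ) (α β : ℂ) (c : ℝ × ℂ × ℝ) : ℂ :=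
  cexp (-(hermTwo c * g).trace) * ((hermTwo c + h).det ^ (α - 2) * (hermTwo c - h).det ^ (β - 2))

/-- SHIMURA'S FUNCTION `η(g, h; α, β)` ON `Herm₂(ℂ)` [Shimura1982, Case II, m = κ = 2]:
`η(g, h; α, β) = ∫_{x ± h > 0} e^{−τ(gx)} det(x + h)^{α−2} det(x − h)^{β−2} dx` (Bochner integral over the chart; a genuine absolutely convergent
integral for `g > 0` and `re α, re β > 1`, and for `h > 0` for all `α`, ★-to-be `K2LiuHermTwoEtaConvergence`; `0` where not integrable). -/
def etaTwo (g h : Matrix (Fin 2) (Fin 2) ℂ) (α β : ℂ) : ℂ :=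
  ∫ c in etaTwoSet h, etaTwoIntegrand g h α β c

/-- Membership in the domain. -/
theorem mem_etaTwoSet_iff (h : Matrix (Fin 2) (Fin 2) ℂ) (c : ℝ × ℂ × ℝ) :
    c ∈ etaTwoSet h ↔ (hermTwo c + h).PosDef ∧ (hermTwo c - h).PosDef := Iff.rfl

/-- Unfolding lemma for the integrand. -/
theorem etaTwoIntegrand_apply (g h : Matrix (Fin 2) (Fin 2) ℂ) (α β : ℂ) (c : ℝ × ℂ × ℝ) :
    etaTwoIntegrand g h α β c =
      cexp (-(hermTwo c * g).trace) * ((hermTwo c + h).det ^ (α - 2) * (hermTwo c - h).det ^ (β - 2)) := rfl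

/-- Unfolding lemma for `η`. -/
theorem etaTwo_def (g h : Matrix (Fin 2) (Fin 2) ℂ) (α β : ℂ) :
    etaTwo g h α β = ∫ c in etaTwoSet h, etaTwoIntegrand g h α β c := rfl

/-! ## The domain in coordinates -/

/-- For Hermitian `h = hermTwo e`, the domain is `{c | hermTwo (c + e) > 0 ∧ hermTwo (c − e) > 0}`, i.e.
`{0 < a + e₁ ∧ |z + e₂|² < (a + e₁)(b + e₃)} ∩ {0 < a − e₁ ∧ |z − e₂|² < (a − e₁)(b − e₃)}`. -/
theorem etaTwoSet_hermTwo (e : ℝ × ℂ × ℝ) :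
    etaTwoSet (hermTwo e) =
      {c : ℝ × ℂ × ℝ | 0 < c.1 + e.1 ∧ normSq (c.2.1 + e.2.1) < (c.1 + e.1) * (c.2.2 + e.2.2)} ∩
        {c | 0 < c.1 - e.1 ∧ normSq (c.2.1 - e.2.1) < (c.1 - e.1) * (c.2.2 - e.2.2)} := by
  ext c
  rw [mem_etaTwoSet_iff, ← hermTwo_add, ← hermTwo_sub, posDef_hermTwo_iff, posDef_hermTwo_iff]
  rfl

/-- The domain is measurable (for Hermitian `h`). -/
theorem measurableSet_etaTwoSet {h : Matrix (Fin 2) (Fin 2) ℂ} (hh : h.IsHermitian) : MeasurableSet (etaTwoSet h) := by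
  rw [← hermTwo_eq_of_isHermitian hh, etaTwoSet_hermTwo]
  refine MeasurableSet.inter ?_ ?_
  · rw [setOf_and]
    refine (measurableSet_lt measurable_const (by fun_prop)).inter (measurableSet_lt ?_ (by fun_prop))
    exact Complex.continuous_normSq.measurable.comp (by fun_prop)
  · rw [setOf_and]
    refine (measurableSet_lt measurable_const (by fun_prop)).inter (measurableSet_lt ?_ (by fun_prop))
    exact Complex.continuous_normSq.measurable.comp (by fun_prop)

/-- The domain is open (for Hermitian `h`). -/
theorem isOpen_etaTwoSet {h : Matrix (Fin 2) (Fin 2) ℂ} (hh : h.IsHermitian) : IsOpen (etaTwoSet h) := by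
  rw [← hermTwo_eq_of_isHermitian hh, etaTwoSet_hermTwo]
  refine IsOpen.inter ?_ ?_
  · rw [setOf_and]
    refine (isOpen_lt continuous_const (by fun_prop)).inter (isOpen_lt ?_ (by fun_prop))
    exact Complex.continuous_normSq.comp (by fun_prop)
  · rw [setOf_and]
    refine (isOpen_lt continuous_const (by fun_prop)).inter (isOpen_lt ?_ (by fun_prop))
    exact Complex.continuous_normSq.comp (by fun_prop)

/-- For `h ≥ 0` the condition `x + h > 0` is implied by `x − h > 0`: the domain is `{x − h > 0}`. -/
theorem etaTwoSet_eq_of_posSemidef {h : Matrix (Fin 2) (Fin 2) ℂ} (hh : h.PosSemidef) :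
    etaTwoSet h = {c | (hermTwo c - h).PosDef} := by
  ext c
  rw [mem_etaTwoSet_iff]
  constructor
  · exact fun hc => hc.2
  · intro hc
    refine ⟨?_, hc⟩
    have : hermTwo c + h = (hermTwo c - h) + (h + h) := by abel
    rw [this]
    exact hc.add_posSemidef (hh.add hh)

/-- On the domain both `x + h` and `x − h` have positive (real) determinant. -/
theorem det_pos_of_mem_etaTwoSet {h : Matrix (Fin 2) (Fin 2) ℂ} {c : ℝ × ℂ × ℝ} (hc : c ∈ etaTwoSet h) :
    0 < (hermTwo c + h).det ∧ 0 < (hermTwo c - h).det :=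
  ⟨hc.1.det_pos, hc.2.det_pos⟩

/-! ## Measurability of the integrand -/

/-- `c ↦ det(hermTwo c + h)` is continuous. -/
theorem continuous_det_hermTwo_add (h : Matrix (Fin 2) (Fin 2) ℂ) : Continuous fun c : ℝ × ℂ × ℝ => (hermTwo c + h).det := by
  have hf : (fun c : ℝ × ℂ × ℝ => (hermTwo c + h).det) =
      fun c => ((c.1 : ℂ) + h 0 0) * ((c.2.2 : ℂ) + h 1 1) - (c.2.1 + h 0 1) * (conj c.2.1 + h 1 0) := by
    funext c
    rw [Matrix.det_fin_two]
    simp [hermTwo]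
  rw [hf]
  fun_prop

/-- `c ↦ det(hermTwo c − h)` is continuous. -/
theorem continuous_det_hermTwo_sub (h : Matrix (Fin 2) (Fin 2) ℂ) : Continuous fun c : ℝ × ℂ × ℝ => (hermTwo c - h).det := by
  have hf : (fun c : ℝ × ℂ × ℝ => (hermTwo c - h).det) =
      fun c => ((c.1 : ℂ) - h 0 0) * ((c.2.2 : ℂ) - h 1 1) - (c.2.1 - h 0 1) * (conj c.2.1 - h 1 0) := by
    funext c
    rw [Matrix.det_fin_two]
    simp [hermTwo]
  rw [hf]
  fun_prop

/-- `c ↦ tr(hermTwo c · g)` is continuous. -/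
theorem continuous_trace_hermTwo_mul (g : Matrix (Fin 2) (Fin 2) ℂ) : Continuous fun c : ℝ × ℂ × ℝ => (hermTwo c * g).trace := by
  have hf : (fun c : ℝ × ℂ × ℝ => (hermTwo c * g).trace) =
      fun c => (c.1 : ℂ) * g 0 0 + c.2.1 * g 1 0 + (conj c.2.1 * g 0 1 + (c.2.2 : ℂ) * g 1 1) := by
    funext c
    rw [Matrix.trace_fin_two, Matrix.mul_apply, Matrix.mul_apply, Fin.sum_univ_two, Fin.sum_univ_two]
    simp [hermTwo]
  rw [hf]
  fun_prop

/-- The `η`-integrand is measurable. -/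
theorem measurable_etaTwoIntegrand (g h : Matrix (Fin 2) (Fin 2) ℂ) (α β : ℂ) : Measurable (etaTwoIntegrand g h α β) := by
  unfold etaTwoIntegrand
  refine Measurable.mul ?_ (Measurable.mul ?_ ?_)
  · exact Complex.measurable_exp.comp (continuous_trace_hermTwo_mul g).measurable.neg
  · exact (continuous_det_hermTwo_add h).measurable.pow_const _
  · exact (continuous_det_hermTwo_sub h).measurable.pow_const _

/-- The `η`-integrand is a.e.-strongly measurable for the restricted measure. -/
theorem aestronglyMeasurable_etaTwoIntegrand (g h : Matrix (Fin 2) (Fin 2) ℂ) (α β : ℂ) (S : Set (ℝ × ℂ × ℝ)) :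
    AEStronglyMeasurable (etaTwoIntegrand g h α β) ((volume : Measure (ℝ × ℂ × ℝ)).restrict S) :=
  (measurable_etaTwoIntegrand g h α β).aestronglyMeasurable

end Summit.HodgeConjecture.HodgeConjecture.Cruxes.HLiu418.K2LiuHermTwoEtaDefs

end
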